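import Mathlib
import Literature.NumberTheory.LFunctions.SuzukiWeilHilbertSpace
import Literature.NumberTheory.LFunctions.SuzukiScrewLineProofs
import Literature.NumberTheory.LFunctions.LiCoefficientsModelSpaceRH
import Literature.NumberTheory.LFunctions.LagariasXiStructureFunctionProofs
import Literature.Analysis.DeBrangesSpaces.ReproducingKernelRealZeros
import Literature.Analysis.DeBrangesSpaces.HalfPlanePaleyWiener
import HarnessLib

/-!
# Suzuki's orthogonal family `ψ_γ ∈ V(0)` under RH — CJM Prop. 4.1 / (4.2) / (5.11) transported to `V(0)`

LINE 1 — LABEL: RH-CONSEQUENCE proofs (every theorem about the zeros carries the explicit binder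
`RiemannHypothesis →`, never dropped); the statements concern the RH-EQUIVALENT·PRINTED residual
`IsolatedV0 = WeilNormIdentityOn (suzukiV 0) ∧ ZeroSeparationOn (suzukiV 0)` of the cell rh-crit/dbl
(M. Suzuki, *On the Hilbert space derived from the Weil distribution*, Canad. J. Math. 2025 =
arXiv:2301.00421v3, Prop. 5.8). bears_on: B-C/B-P (LADDER-RH COLUMN 6 DBR). WHAT THIS IS NOT: not a
route, not a proof plan for RH; proving the direction «RH ⟹ condition (2)» of an RH-EQUIVALENT
criterion fixes the kernel status of the criterion, it does not move RH; nothing here bears on the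
truth of RH.

## What is proved (all under the RH binder)

For every non-trivial zero `ρ` (parameter `γ = i(ρ − ½)`, multiplicity `m = m_γ`), an element
`ψ_γ ∈ V(0) = L²(0,∞) ∩ 𝖪L²(0,∞)` with
* `ψ̂_γ(γ) = 1/√(m_γ π)` and `ψ̂_γ(γ′) = 0` for `γ′ ∈ Γ∖{γ}` (values in the junk-free sense
  `HasHatValue`; CJM (4.2) with `F_γ = ψ̂_γ`, (5.11));
* `2π‖ψ_γ‖² = 1` and `⟨ψ_γ, ψ_γ′⟩ = 0` for `γ ≠ γ′` (CJM (5.11), Prop. 4.1 orthonormality);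
i.e. clauses 1–5 of the cell's RH-CONSEQUENCE fact `Suzuki2025_orthogonalBasis`
(`suzuki2025_orthogonalSet_of_riemannHypothesis`); the completeness clause 6 (de Branges' Thm. 22 /
the ordering theorem) is NOT proved here and `Suzuki2025_orthogonalBasis` remains a named fact.
Consequences: `zeroSeparationOn_suzukiV_zero_of_riemannHypothesis` — **CJM Prop. 5.8 `⟹`,
condition (2), with no named fact** — and `suzukiV_zero_ne_singleton_of_riemannHypothesis`
(Remark 5.2: RH ⟹ `V(0) ≠ {0}`, with no named fact).

## The argument

Under RH `E = E_ξ` is Hermite–Biehler ([La06] Thm. 1, the tree's `Lagarias2006_thm1_onlyif_holds`).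
Put `S_γ(z) := √(m/π)·i·A(z)/(z − γ)` (entire: `A(γ) = ξ(ρ) = 0`; `A = (E + E♯)/2 = ξ(½ − i·)`), so
that `S_γ/E = F_γ = √(m/π)·i(1 + Θ)/(2(z − γ))` off the zeros of `E` (`screwBasis`, CJM (3.5)).
`F_γ|_ℝ ∈ L²` (the tree's `memLp_two_screwBasis`), so de Branges' removable-singularity lemma
(`DeBrangesSpaces.exists_continuation_div`) continues `S_γ/E` to a function `G_γ` complex
differentiable on the CLOSED upper half-plane; `|G_γ(z)| ≤ √(m/π)/|z − γ|` there (`|A/E| ≤ 1`).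
Paley–Wiener by duality (`DeBrangesSpaces.integral_Ioi_fourierInv_mul_cexp_eq`,
`DeBrangesSpaces.fourierInv_ae_eq_zero_of_neg`) gives `ψ_γ := 𝓕⁻¹(G_γ(−2π·)) ∈ L²(0,∞)` with
`ψ̂_γ = G_γ` on `ℂ₊`; on the line `Θ · conj G_γ = −G_γ` (`γ` real, `A` real, `|Θ| = 1`), so
`𝖪ψ_γ = −ψ_γ ∈ L²(0,∞)` and `ψ_γ ∈ V(0)`. The boundary values are the printed (4.2)
(`Suzuki2025_prop41_eq42`, continuity of `G_γ`), and the Gram matrix is dbl-t11's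
`integral_kernel_offDiag` / `integral_kernel_diag` (the `L²(ℝ)` orthogonality relations of
`i(1+Θ)/(2(x−γ))`, [Su23b] Prop. 3.2) transported by Plancherel.

## References
* M. Suzuki, Canad. J. Math. 2025 = arXiv:2301.00421v3, Prop. 4.1, (3.5), (4.2), (5.11), Prop. 5.8,
  Remark 5.2. [Suzuki2025WeilHilbertSpace]
* M. Suzuki, J. Number Theory 252 (2023), Prop. 3.2. [Suzuki2023b]
* W. Rudin, *Real and complex analysis*, Thm. 19.2 (Paley–Wiener). [Rudin1987]
-/

noncomputable section

open MeasureTheory Complex Filter Set FourierTransform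
open scoped ComplexConjugate FourierTransform Topology Real ENNReal InnerProductSpace

namespace Literature.NumberTheory.LFunctions

open ZetaZeros Literature.Analysis.DeBrangesSpaces

namespace SuzukiOrthogonalSet

/-! ## A. The entire numerator `S_γ = √(m/π)·i·A/(z − γ)` and the quotient `S_γ/E = F_γ` -/

/-- `A(γ_ρ) = ξ(ρ) = 0` at a non-trivial zero `ρ`. [cite: Suzuki2025WeilHilbertSpace, CJM §1 p. 2 ("Γ … the set of all zeros of ξ(1/2 − iz)")] -/
theorem lagariasXiA_suzukiZeroParam {ρ : ℂ} (hρ : ρ ∈ riemannZetaNontrivialZeros) :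
    lagariasXiA (suzukiZeroParam ρ) = 0 := by
  rw [lagariasXiA_eq, one_half_sub_I_mul_suzukiZeroParam]
  exact (riemannXi_eq_zero_iff_holds ρ).2 (riemannZetaNontrivialZeros.mem_iff'.1 hρ)

/-- The divided difference `A(z)/(z − γ)` (`dslope A γ`, value `A′(γ)` at `γ`) is entire.
[cite: Suzuki2025WeilHilbertSpace, CJM eq. (3.5) p. 9 (F_γ is regular at z = γ)] -/
theorem differentiable_dslope_lagariasXiA (γ : ℂ) : Differentiable ℂ (dslope lagariasXiA γ) :=
  differentiableOn_univ.1
    ((Complex.differentiableOn_dslope univ_mem).2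
      differentiable_lagariasXiA.differentiableOn)

/-- Off `γ`, `dslope A γ z = A(z)/(z − γ)` (since `A(γ) = 0`). [cite: Suzuki2025WeilHilbertSpace, CJM eq. (3.5) p. 9] -/
theorem dslope_lagariasXiA_eq {ρ : ℂ} (hρ : ρ ∈ riemannZetaNontrivialZeros) {z : ℂ}
    (hz : z ≠ suzukiZeroParam ρ) :
    dslope lagariasXiA (suzukiZeroParam ρ) z = lagariasXiA z / (z - suzukiZeroParam ρ) := by
  rw [dslope_of_ne _ hz, slope_def_field, lagariasXiA_suzukiZeroParam hρ, sub_zero]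

/-- `1 + Θ = 2A/E` wherever `E ≠ 0` (`A = (E + E♯)/2`, `Θ = E♯/E`). [cite: Suzuki2025WeilHilbertSpace, CJM eq. (3.3)–(3.5) p. 8–9] -/
theorem one_add_lagariasTheta {z : ℂ} (hE : lagariasE z ≠ 0) :
    1 + lagariasTheta z = 2 * lagariasXiA z / lagariasE z := by
  rw [lagariasTheta, lagariasXiA]
  field_simp

/-- **`F_γ = S_γ/E` off the zeros of `E` and off `γ`**: `screwBasis ρ z = √(m/π)·i·(A(z)/(z−γ))/E(z)`.
[cite: Suzuki2025WeilHilbertSpace, CJM eq. (3.5) p. 9 (TeX l.1019–1025)] -/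
theorem screwBasis_eq_div {ρ : ℂ} (hρ : ρ ∈ riemannZetaNontrivialZeros) {z : ℂ}
    (hE : lagariasE z ≠ 0) (hz : z ≠ suzukiZeroParam ρ) :
    screwBasis ρ z =
      ((Real.sqrt ((riemannZetaZeroOrder ρ : ℝ) / Real.pi) : ℝ) : ℂ) * I *
          dslope lagariasXiA (suzukiZeroParam ρ) z / lagariasE z := by
  rw [screwBasis, one_add_lagariasTheta hE, dslope_lagariasXiA_eq hρ hz]
  have hz' : z - suzukiZeroParam ρ ≠ 0 := sub_ne_zero.2 hz
  field_simp

/-- Almost every real `x` is neither a zero of `E` nor the point `γ`. [cite: Suzuki2025WeilHilbertSpace, CJM §3.2 p. 8 ("|Θ(z)| = 1 for every z ∈ ℝ … zeros of E … cancel out")] -/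
theorem ae_lagariasE_ne_zero_and_ne (γ : ℂ) :
    ∀ᵐ x : ℝ, lagariasE (x : ℂ) ≠ 0 ∧ (x : ℂ) ≠ γ := by
  have h2 : ∀ᵐ x : ℝ, (x : ℂ) ≠ γ := by
    have : ∀ᵐ x : ℝ, x ≠ γ.re := compl_mem_ae_iff.2 (measure_singleton γ.re)
    filter_upwards [this] with x hx h
    exact hx (by rw [← h, Complex.ofReal_re])
  filter_upwards [ae_lagariasE_ofReal_ne_zero, h2] with x h1 h2
  exact ⟨h1, h2⟩

/-- `S_γ/E = F_γ` almost everywhere on `ℝ`. [cite: Suzuki2025WeilHilbertSpace, CJM eq. (3.5) p. 9] -/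
theorem div_ae_eq_screwBasis {ρ : ℂ} (hρ : ρ ∈ riemannZetaNontrivialZeros) :
    (fun x : ℝ ↦ ((Real.sqrt ((riemannZetaZeroOrder ρ : ℝ) / Real.pi) : ℝ) : ℂ) * I *
          dslope lagariasXiA (suzukiZeroParam ρ) x / lagariasE x) =ᵐ[volume]
      fun x : ℝ ↦ screwBasis ρ x := by
  filter_upwards [ae_lagariasE_ne_zero_and_ne (suzukiZeroParam ρ)] with x hx
  exact (screwBasis_eq_div hρ hx.1 hx.2).symm

/-- `∫_ℝ |S_γ/E|² < ∞` (it is `|F_γ|²` a.e., and `F_γ|_ℝ ∈ L²`, `memLp_two_screwBasis`).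
[cite: Suzuki2025WeilHilbertSpace, CJM Prop. 4.1 p. 10 ("F_γ … of 𝒦(Θ)") and eq. (3.5)] -/
theorem integrable_sq_norm_div {ρ : ℂ} (hρ : ρ ∈ riemannZetaNontrivialZeros) :
    Integrable fun x : ℝ ↦
      ‖((Real.sqrt ((riemannZetaZeroOrder ρ : ℝ) / Real.pi) : ℝ) : ℂ) * I *
          dslope lagariasXiA (suzukiZeroParam ρ) x / lagariasE x‖ ^ 2 := by
  have h := (memLp_two_iff_integrable_sq_norm (memLp_two_screwBasis hρ).1).1
    (memLp_two_screwBasis hρ)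
  refine h.congr ?_
  filter_upwards [div_ae_eq_screwBasis hρ] with x hx
  rw [hx]

/-! ## B. The continuation `G_γ` of `S_γ/E` to the closed upper half-plane (under RH) -/

/-- **The continuation.** Under RH there is `G_γ`, complex differentiable at every point of the
closed upper half-plane, with `G_γ = S_γ/E` wherever `E ≠ 0` — hence `G_γ = F_γ` off the real
zeros of `E` and `γ` (de Branges' removable-singularity lemma `exists_continuation_div` for the
Hermite–Biehler function `E_ξ`, [La06] Thm. 1). RH-CONSEQUENCE.
[cite: Suzuki2025WeilHilbertSpace, CJM Prop. 4.1 p. 10 and §3.2 p. 8 (TeX l.985–990: "F_γ … is holomorphic there")] -/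
theorem exists_continuation (hRH : RiemannHypothesis) {ρ : ℂ}
    (hρ : ρ ∈ riemannZetaNontrivialZeros) :
    ∃ G : ℂ → ℂ, (∀ z : ℂ, 0 ≤ z.im → DifferentiableAt ℂ G z) ∧
      ∀ z : ℂ, lagariasE z ≠ 0 → G z =
        ((Real.sqrt ((riemannZetaZeroOrder ρ : ℝ) / Real.pi) : ℝ) : ℂ) * I *
          dslope lagariasXiA (suzukiZeroParam ρ) z / lagariasE z := by
  have hE : IsHermiteBiehler lagariasE := Lagarias2006_thm1_onlyif_holds hRH
  have hS : Differentiable ℂ fun z : ℂ ↦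
      ((Real.sqrt ((riemannZetaZeroOrder ρ : ℝ) / Real.pi) : ℝ) : ℂ) * I *
        dslope lagariasXiA (suzukiZeroParam ρ) z :=
    (differentiable_const _).mul (differentiable_dslope_lagariasXiA _)
  exact exists_continuation_div hE hS (integrable_sq_norm_div hρ)

section WithG

variable {ρ : ℂ} {G : ℂ → ℂ}

/-- `G_γ = F_γ` off the zeros of `E` and off `γ`. [cite: Suzuki2025WeilHilbertSpace, CJM eq. (3.5) p. 9] -/
theorem continuation_eq_screwBasis (hρ : ρ ∈ riemannZetaNontrivialZeros)
    (hGeq : ∀ z : ℂ, lagariasE z ≠ 0 → G z =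
        ((Real.sqrt ((riemannZetaZeroOrder ρ : ℝ) / Real.pi) : ℝ) : ℂ) * I *
          dslope lagariasXiA (suzukiZeroParam ρ) z / lagariasE z)
    {z : ℂ} (hE : lagariasE z ≠ 0) (hz : z ≠ suzukiZeroParam ρ) :
    G z = screwBasis ρ z := by
  rw [hGeq z hE, screwBasis_eq_div hρ hE hz]

/-- `G_γ = F_γ` almost everywhere on the real line. [cite: Suzuki2025WeilHilbertSpace, CJM eq. (3.5) p. 9] -/
theorem continuation_ae_eq_screwBasis (hρ : ρ ∈ riemannZetaNontrivialZeros)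
    (hGeq : ∀ z : ℂ, lagariasE z ≠ 0 → G z =
        ((Real.sqrt ((riemannZetaZeroOrder ρ : ℝ) / Real.pi) : ℝ) : ℂ) * I *
          dslope lagariasXiA (suzukiZeroParam ρ) z / lagariasE z) :
    (fun x : ℝ ↦ G x) =ᵐ[volume] fun x : ℝ ↦ screwBasis ρ x := by
  filter_upwards [ae_lagariasE_ne_zero_and_ne (suzukiZeroParam ρ)] with x hx
  exact continuation_eq_screwBasis hρ hGeq hx.1 hx.2

/-- `∫_ℝ |G_γ|² < ∞`. [cite: Suzuki2025WeilHilbertSpace, CJM Prop. 4.1 p. 10 ("F_γ … of 𝒦(Θ) ⊂ L²(ℝ)")] -/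
theorem integrable_sq_norm_continuation (hρ : ρ ∈ riemannZetaNontrivialZeros)
    (hGeq : ∀ z : ℂ, lagariasE z ≠ 0 → G z =
        ((Real.sqrt ((riemannZetaZeroOrder ρ : ℝ) / Real.pi) : ℝ) : ℂ) * I *
          dslope lagariasXiA (suzukiZeroParam ρ) z / lagariasE z) :
    Integrable fun x : ℝ ↦ ‖G x‖ ^ 2 := by
  have h := (memLp_two_iff_integrable_sq_norm (memLp_two_screwBasis hρ).1).1
    (memLp_two_screwBasis hρ)
  refine h.congr ?_
  filter_upwards [continuation_ae_eq_screwBasis hρ hGeq] with x hx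
  rw [hx]

/-- **Decay of `G_γ` on the upper half-plane** (under RH): `‖G_γ(z)‖ ≤ 2√(m/π)/√(Im z)` for
`Im z > 0`, `‖z‖ ≥ max 1 (2‖γ‖ + 1)` — from `|A/E| ≤ 1` on `ℂ₊` (`E` Hermite–Biehler) and
`|z − γ| ≥ ‖z‖/2`. RH-CONSEQUENCE. [cite: Suzuki2025WeilHilbertSpace, CJM §3.2 p. 8 (TeX l.985–990: "|Θ(z)| < 1 on ℂ₊") and eq. (3.5)] -/
theorem norm_continuation_le (hRH : RiemannHypothesis) (hρ : ρ ∈ riemannZetaNontrivialZeros)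
    (hGeq : ∀ z : ℂ, lagariasE z ≠ 0 → G z =
        ((Real.sqrt ((riemannZetaZeroOrder ρ : ℝ) / Real.pi) : ℝ) : ℂ) * I *
          dslope lagariasXiA (suzukiZeroParam ρ) z / lagariasE z)
    {z : ℂ} (hz : 0 < z.im) (hR : max 1 (2 * ‖suzukiZeroParam ρ‖ + 1) ≤ ‖z‖) :
    ‖G z‖ ≤ 2 * Real.sqrt ((riemannZetaZeroOrder ρ : ℝ) / Real.pi) / √z.im := by
  set γ := suzukiZeroParam ρ with hγ
  set c : ℝ := Real.sqrt ((riemannZetaZeroOrder ρ : ℝ) / Real.pi) with hc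
  have hc0 : 0 ≤ c := Real.sqrt_nonneg _
  have h1 : (1 : ℝ) ≤ ‖z‖ := (le_max_left _ _).trans hR
  have h2 : 2 * ‖γ‖ + 1 ≤ ‖z‖ := (le_max_right _ _).trans hR
  have hzγ : z ≠ γ := by
    intro h; rw [h] at h2; linarith [norm_nonneg γ]
  have hE : lagariasE z ≠ 0 := lagariasE_ne_zero_of_im_pos hRH hz
  have hGz : G z = (c : ℂ) * I * (lagariasXiA z / lagariasE z) / (z - γ) := by
    rw [hGeq z hE, dslope_lagariasXiA_eq hρ hzγ, ← hγ]
    field_simp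
  have hAE : ‖lagariasXiA z / lagariasE z‖ ≤ 1 := norm_lagariasXiA_div_lagariasE_le_one hRH hz.le
  have hzγ' : ‖z‖ / 2 ≤ ‖z - γ‖ := by
    have := norm_sub_norm_le z γ
    linarith
  have hzpos : 0 < ‖z‖ := by linarith
  have hsqrt : √z.im ≤ ‖z‖ := sqrt_im_le_norm h1
  have hsqrt0 : 0 < √z.im := Real.sqrt_pos.2 hz
  rw [hGz, norm_div, norm_mul, norm_mul, Complex.norm_real, Complex.norm_I, mul_one,
    Real.norm_of_nonneg hc0]
  calc c * ‖lagariasXiA z / lagariasE z‖ / ‖z - γ‖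
      ≤ c * 1 / (‖z‖ / 2) :=
        div_le_div₀ (by rw [mul_one]; exact hc0) (mul_le_mul_of_nonneg_left hAE hc0)
          (by positivity) hzγ'
    _ = 2 * c / ‖z‖ := by field_simp
    _ ≤ 2 * c / √z.im := by gcongr

/-- Near every real parameter `γ′ = γ_{ρ′}`, `G_γ` agrees with `F_γ` on a punctured neighbourhood
(the zeros of the entire function `E ≢ 0` are isolated). RH-FREE given the continuation.
[cite: Suzuki2025WeilHilbertSpace, CJM Prop. 4.1 eq. (4.2) p. 10] -/
theorem continuation_eventuallyEq_screwBasis (hρ : ρ ∈ riemannZetaNontrivialZeros)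
    (hGeq : ∀ z : ℂ, lagariasE z ≠ 0 → G z =
        ((Real.sqrt ((riemannZetaZeroOrder ρ : ℝ) / Real.pi) : ℝ) : ℂ) * I *
          dslope lagariasXiA (suzukiZeroParam ρ) z / lagariasE z)
    (w : ℂ) : G =ᶠ[𝓝[≠] w] screwBasis ρ := by
  -- `E ≠ 0` on a punctured neighbourhood of `w`
  have hEa : AnalyticAt ℂ lagariasE w := differentiable_lagariasE.analyticAt w
  have hE : ∀ᶠ z in 𝓝[≠] w, lagariasE z ≠ 0 := by
    rcases hEa.eventually_eq_zero_or_eventually_ne_zero with h | h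
    · -- `E` would vanish identically (identity theorem), contradicting `E(0) ≠ 0`
      exfalso
      have han : AnalyticOnNhd ℂ lagariasE univ := fun z _ ↦ differentiable_lagariasE.analyticAt z
      have hzero := han.eqOn_zero_of_preconnected_of_eventuallyEq_zero isPreconnected_univ
        (mem_univ w) h (mem_univ (0 : ℂ))
      exact lagariasE_zero_ne_zero hzero
    · exact h
  -- `z ≠ γ` on a punctured neighbourhood of `w`
  have hne : ∀ᶠ z in 𝓝[≠] w, z ≠ suzukiZeroParam ρ := by
    by_cases hw : w = suzukiZeroParam ρ
    · rw [hw]; exact self_mem_nhdsWithin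
    · exact (isOpen_ne.eventually_mem hw).filter_mono nhdsWithin_le_nhds
  filter_upwards [hE, hne] with z h1 h2
  exact continuation_eq_screwBasis hρ hGeq h1 h2

/-- **The values (4.2) of the continuation**: `G_γ(γ) = 1/√(m_γπ)` and `G_γ(γ′) = 0` for
`γ′ ∈ Γ∖{γ}` (continuity of `G_γ` at the real points `γ, γ′` and the limits
`Suzuki2025_prop41_eq42`). RH-CONSEQUENCE. [cite: Suzuki2025WeilHilbertSpace, CJM Prop. 4.1 eq. (4.2) p. 10 (TeX l.1128–1135)] -/
theorem continuation_apply_suzukiZeroParam (hRH : RiemannHypothesis)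
    (hρ : ρ ∈ riemannZetaNontrivialZeros)
    (hGd : ∀ z : ℂ, 0 ≤ z.im → DifferentiableAt ℂ G z)
    (hGeq : ∀ z : ℂ, lagariasE z ≠ 0 → G z =
        ((Real.sqrt ((riemannZetaZeroOrder ρ : ℝ) / Real.pi) : ℝ) : ℂ) * I *
          dslope lagariasXiA (suzukiZeroParam ρ) z / lagariasE z) :
    G (suzukiZeroParam ρ) =
        (((1 / Real.sqrt ((riemannZetaZeroOrder ρ : ℝ) * Real.pi) : ℝ)) : ℂ) ∧
      ∀ ρ' ∈ riemannZetaNontrivialZeros, ρ' ≠ ρ → G (suzukiZeroParam ρ') = 0 := by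
  have hcont : ∀ ρ'' ∈ riemannZetaNontrivialZeros,
      Tendsto G (𝓝[≠] suzukiZeroParam ρ'') (𝓝 (G (suzukiZeroParam ρ''))) := by
    intro ρ'' hρ''
    have him : 0 ≤ (suzukiZeroParam ρ'').im := (suzukiZeroParam_im_eq_zero hRH hρ'').ge
    exact ((hGd _ him).continuousAt.tendsto).mono_left nhdsWithin_le_nhds
  obtain ⟨h1, h2⟩ := Suzuki2025_prop41_eq42 ρ hρ
  refine ⟨?_, fun ρ' hρ' hne ↦ ?_⟩
  · exact tendsto_nhds_unique
      ((hcont ρ hρ).congr' (continuation_eventuallyEq_screwBasis hρ hGeq _)) h1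
  · exact tendsto_nhds_unique
      ((hcont ρ' hρ').congr' (continuation_eventuallyEq_screwBasis hρ hGeq _)) (h2 ρ' hρ' hne)

/-- On the real line, off the zeros of `E` and off `γ`: **`Θ(x)·conj G_γ(x) = −G_γ(x)`** (under RH
`γ` is real; `A` is real on `ℝ`; `|Θ(x)| = 1`). This is `(𝖥𝖪ψ_γ) = Θ(𝖥ψ_γ)♯ = −𝖥ψ_γ`, i.e.
`𝖪ψ_γ = −ψ_γ` (CJM Remark 5.2: the basis vectors are eigenvectors of the involution `𝖪`).
RH-CONSEQUENCE. [cite: Suzuki2025WeilHilbertSpace, CJM Remark 5.2 p. 14 (TeX l.1500–1510) and eq. (5.1)] -/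
theorem lagariasTheta_mul_conj_continuation (hRH : RiemannHypothesis)
    (hρ : ρ ∈ riemannZetaNontrivialZeros)
    (hGeq : ∀ z : ℂ, lagariasE z ≠ 0 → G z =
        ((Real.sqrt ((riemannZetaZeroOrder ρ : ℝ) / Real.pi) : ℝ) : ℂ) * I *
          dslope lagariasXiA (suzukiZeroParam ρ) z / lagariasE z)
    {x : ℝ} (hE : lagariasE (x : ℂ) ≠ 0) (hx : (x : ℂ) ≠ suzukiZeroParam ρ) :
    lagariasTheta x * conj (G x) = -G x := by
  set γ := suzukiZeroParam ρ with hγ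
  set c : ℝ := Real.sqrt ((riemannZetaZeroOrder ρ : ℝ) / Real.pi) with hc
  have hγreal : conj γ = γ := by
    rw [hγ, suzukiZeroParam_eq_ofReal hRH hρ, Complex.conj_ofReal]
  have hΘ1 : lagariasTheta x * conj (lagariasTheta x) = 1 := by
    rw [Complex.mul_conj, Complex.normSq_eq_norm_sq, norm_lagariasTheta_ofReal hE]
    norm_num
  have hG : G x = (c : ℂ) * (I * (1 + lagariasTheta x) / (2 * ((x : ℂ) - γ))) := by
    rw [continuation_eq_screwBasis hρ hGeq hE hx, screwBasis]
  have hconj : conj (G x) =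
      (c : ℂ) * (-I) * (1 + conj (lagariasTheta x)) / (2 * ((x : ℂ) - γ)) := by
    rw [hG]
    simp only [map_mul, map_div₀, map_add, map_one, map_sub, Complex.conj_ofReal, Complex.conj_I,
      map_ofNat, hγreal]
    ring
  have hΘ2 : lagariasTheta x * (1 + conj (lagariasTheta x)) = lagariasTheta x + 1 := by
    rw [mul_add, mul_one, hΘ1]
  calc lagariasTheta x * conj (G x)
      = -((c : ℂ) * I * (lagariasTheta x * (1 + conj (lagariasTheta x))) / (2 * ((x : ℂ) - γ))) := by
        rw [hconj]; ring
    _ = -((c : ℂ) * I * (lagariasTheta x + 1) / (2 * ((x : ℂ) - γ))) := by rw [hΘ2]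
    _ = -G x := by rw [hG]; ring


/-! ## C. `ψ_γ := 𝓕⁻¹(G_γ(−2π·))`: Paley–Wiener, `𝖪ψ_γ = −ψ_γ`, membership in `V(0)`, values -/

/-- The Fourier-side class `ξ ↦ G_γ(−2πξ)` is in `L²(ℝ)`. [cite: Suzuki2025WeilHilbertSpace, CJM Prop. 4.1 p. 10 ("F_γ … of 𝒦(Θ) ⊂ L²(ℝ)")] -/
theorem memLp_two_continuation_dilate (hρ : ρ ∈ riemannZetaNontrivialZeros)
    (hGd : ∀ z : ℂ, 0 ≤ z.im → DifferentiableAt ℂ G z)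
    (hGeq : ∀ z : ℂ, lagariasE z ≠ 0 → G z =
        ((Real.sqrt ((riemannZetaZeroOrder ρ : ℝ) / Real.pi) : ℝ) : ℂ) * I *
          dslope lagariasXiA (suzukiZeroParam ρ) z / lagariasE z) :
    MemLp (fun ξ : ℝ ↦ G ((-(2 * π) * ξ : ℝ) : ℂ)) 2 volume :=
  memLp_two_boundary_dilate hGd (integrable_sq_norm_continuation hρ hGeq)

variable (hG2 : MemLp (fun ξ : ℝ ↦ G ((-(2 * π) * ξ : ℝ) : ℂ)) 2 volume)

/-- **`ψ_γ ∈ L²(0,∞)`** (Paley–Wiener by duality for the boundary-regular `G_γ`). RH-CONSEQUENCE.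
[cite: Suzuki2025WeilHilbertSpace, CJM eq. (5.11) p. 15 ("each ψ_γ belongs to V(0)") and §2.3 ("H² = 𝖥L²(0,∞)")] -/
theorem fourierInv_mem_halfLineL2 (hRH : RiemannHypothesis) (hρ : ρ ∈ riemannZetaNontrivialZeros)
    (hGd : ∀ z : ℂ, 0 ≤ z.im → DifferentiableAt ℂ G z)
    (hGeq : ∀ z : ℂ, lagariasE z ≠ 0 → G z =
        ((Real.sqrt ((riemannZetaZeroOrder ρ : ℝ) / Real.pi) : ℝ) : ℂ) * I *
          dslope lagariasXiA (suzukiZeroParam ρ) z / lagariasE z) :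
    (𝓕⁻ (hG2.toLp _ : Lp ℂ 2 (volume : Measure ℝ)) : Lp ℂ 2 (volume : Measure ℝ)) ∈
      halfLineL2 0 :=
  fourierInv_ae_eq_zero_of_neg (by positivity) hGd (integrable_sq_norm_continuation hρ hGeq)
    (fun _ hz hR ↦ norm_continuation_le hRH hρ hGeq hz hR) hG2

/-- **`ψ̂_γ = G_γ` on `ℂ₊`**: `∫₀^∞ ψ_γ(x)e^{iwx}dx = G_γ(w)` for `Im w > 0`. RH-CONSEQUENCE.
[cite: Suzuki2025WeilHilbertSpace, CJM eq. (5.11) p. 15 ("F_γ = ψ̂_γ")] -/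
theorem upperHalfHat_fourierInv (hRH : RiemannHypothesis) (hρ : ρ ∈ riemannZetaNontrivialZeros)
    (hGd : ∀ z : ℂ, 0 ≤ z.im → DifferentiableAt ℂ G z)
    (hGeq : ∀ z : ℂ, lagariasE z ≠ 0 → G z =
        ((Real.sqrt ((riemannZetaZeroOrder ρ : ℝ) / Real.pi) : ℝ) : ℂ) * I *
          dslope lagariasXiA (suzukiZeroParam ρ) z / lagariasE z)
    {w : ℂ} (hw : 0 < w.im) :
    upperHalfHat (𝓕⁻ (hG2.toLp _ : Lp ℂ 2 (volume : Measure ℝ)) : Lp ℂ 2 (volume : Measure ℝ)) w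
      = G w :=
  integral_Ioi_fourierInv_mul_cexp_eq (by positivity) hGd (integrable_sq_norm_continuation hρ hGeq)
    (fun _ hz hR ↦ norm_continuation_le hRH hρ hGeq hz hR) hG2 hw

/-- **`𝖪ψ_γ = −ψ_γ`** (`𝖥ψ_γ = G_γ` on the line and `Θ·conj G_γ = −G_γ` a.e.). RH-CONSEQUENCE.
[cite: Suzuki2025WeilHilbertSpace, CJM Remark 5.2 p. 14 and eq. (5.1)] -/
theorem suzukiK_fourierInv (hRH : RiemannHypothesis) (hρ : ρ ∈ riemannZetaNontrivialZeros)
    (hGeq : ∀ z : ℂ, lagariasE z ≠ 0 → G z =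
        ((Real.sqrt ((riemannZetaZeroOrder ρ : ℝ) / Real.pi) : ℝ) : ℂ) * I *
          dslope lagariasXiA (suzukiZeroParam ρ) z / lagariasE z) :
    suzukiK (𝓕⁻ (hG2.toLp _ : Lp ℂ 2 (volume : Measure ℝ)) : Lp ℂ 2 (volume : Measure ℝ)) =
      -(𝓕⁻ (hG2.toLp _ : Lp ℂ 2 (volume : Measure ℝ)) : Lp ℂ 2 (volume : Measure ℝ)) := by
  set F : Lp ℂ 2 (volume : Measure ℝ) := hG2.toLp _ with hF
  -- the pointwise identity, transported to the Fourier variable `ξ ↦ −2πξ`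
  have hq : Measure.QuasiMeasurePreserving (fun ξ : ℝ ↦ -(2 * π) * ξ) volume volume := by
    refine ⟨measurable_const_mul _, ?_⟩
    rw [Real.map_volume_mul_left (neg_ne_zero.2 Real.two_pi_pos.ne')]
    exact Measure.smul_absolutelyContinuous
  have hae : ∀ᵐ ξ : ℝ, suzukiMultiplier ξ * conj (G ((-(2 * π) * ξ : ℝ) : ℂ)) =
      -G ((-(2 * π) * ξ : ℝ) : ℂ) := by
    filter_upwards [hq.ae (ae_lagariasE_ne_zero_and_ne (suzukiZeroParam ρ))] with ξ hξ
    have e : ((-2 * Real.pi * ξ : ℝ) : ℂ) = ((-(2 * π) * ξ : ℝ) : ℂ) := by push_cast; ring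
    rw [suzukiMultiplier, e]
    exact lagariasTheta_mul_conj_continuation hRH hρ hGeq hξ.1 hξ.2
  have hMJ : suzukiM (suzukiJ F) = -F := by
    refine Lp.ext ?_
    filter_upwards [coeFn_suzukiM (suzukiJ F), coeFn_suzukiJ F, hG2.coeFn_toLp, Lp.coeFn_neg F,
      hae] with ξ h1 h2 h3 h4 h5
    rw [h1, h2, h4, Pi.neg_apply, h3, h5]
  unfold suzukiK
  rw [fourier_fourierInv_eq, hMJ, ← neg_one_smul ℂ F, fourierInv_smul, neg_one_smul]

/-- **`ψ_γ ∈ V(0)`** = `L²(0,∞) ∩ 𝖪L²(0,∞)`. RH-CONSEQUENCE.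
[cite: Suzuki2025WeilHilbertSpace, CJM eq. (5.11) p. 15 (TeX l.1700–1705: "each ψ_γ belongs to V(0)")] -/
theorem fourierInv_mem_suzukiV (hRH : RiemannHypothesis) (hρ : ρ ∈ riemannZetaNontrivialZeros)
    (hGd : ∀ z : ℂ, 0 ≤ z.im → DifferentiableAt ℂ G z)
    (hGeq : ∀ z : ℂ, lagariasE z ≠ 0 → G z =
        ((Real.sqrt ((riemannZetaZeroOrder ρ : ℝ) / Real.pi) : ℝ) : ℂ) * I *
          dslope lagariasXiA (suzukiZeroParam ρ) z / lagariasE z) :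
    (𝓕⁻ (hG2.toLp _ : Lp ℂ 2 (volume : Measure ℝ)) : Lp ℂ 2 (volume : Measure ℝ)) ∈ suzukiV 0 := by
  have h1 := fourierInv_mem_halfLineL2 hG2 hRH hρ hGd hGeq
  refine mem_suzukiV_iff.2 ⟨h1, ?_⟩
  rw [suzukiK_fourierInv hG2 hRH hρ hGeq, ← zero_sub]
  exact sub_mem_halfLineL2 (zero_mem_halfLineL2 0) h1

/-- **The values `ψ̂_γ(γ′) = G_γ(γ′)` at the (real) zeros**, in the junk-free sense `HasHatValue`
(boundary clause: `ψ̂_γ(γ′ + iy) = G_γ(γ′ + iy) → G_γ(γ′)` as `y ↓ 0`, by continuity of the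
continuation). RH-CONSEQUENCE. [cite: Suzuki2025WeilHilbertSpace, CJM Prop. 4.1 eq. (4.2) p. 10 and (5.11)] -/
theorem hasHatValue_fourierInv (hRH : RiemannHypothesis) (hρ : ρ ∈ riemannZetaNontrivialZeros)
    (hGd : ∀ z : ℂ, 0 ≤ z.im → DifferentiableAt ℂ G z)
    (hGeq : ∀ z : ℂ, lagariasE z ≠ 0 → G z =
        ((Real.sqrt ((riemannZetaZeroOrder ρ : ℝ) / Real.pi) : ℝ) : ℂ) * I *
          dslope lagariasXiA (suzukiZeroParam ρ) z / lagariasE z)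
    {ρ' : ℂ} (hρ' : ρ' ∈ riemannZetaNontrivialZeros) :
    HasHatValue (𝓕⁻ (hG2.toLp _ : Lp ℂ 2 (volume : Measure ℝ)) : Lp ℂ 2 (volume : Measure ℝ))
      (suzukiZeroParam ρ') (G (suzukiZeroParam ρ')) := by
  set γ' := suzukiZeroParam ρ' with hγ'
  have him : γ'.im = 0 := suzukiZeroParam_im_eq_zero hRH hρ'
  refine Or.inr (Or.inr ⟨him, ?_⟩)
  have hpos : ∀ y : ℝ, 0 < y → 0 < (γ' + I * y).im := fun y hy ↦ by simpa [him] using hy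
  have hcont : Tendsto (fun y : ℝ ↦ G (γ' + I * y)) (𝓝[>] 0) (𝓝 (G γ')) := by
    have h1 : Tendsto (fun y : ℝ ↦ γ' + I * y) (𝓝 0) (𝓝 γ') := by
      have : Tendsto (fun y : ℝ ↦ γ' + I * y) (𝓝 0) (𝓝 (γ' + I * (0 : ℝ))) :=
        (continuous_const.add (continuous_const.mul Complex.continuous_ofReal)).tendsto 0
      rwa [Complex.ofReal_zero, mul_zero, add_zero] at this
    exact ((hGd γ' him.ge).continuousAt.tendsto.comp h1).mono_left nhdsWithin_le_nhds
  refine hcont.congr' ?_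
  filter_upwards [self_mem_nhdsWithin] with y hy
  exact (upperHalfHat_fourierInv hG2 hRH hρ hGd hGeq (hpos y hy)).symm

/-! ## D. The Gram matrix: `2π‖ψ_γ‖² = 1`, `⟨ψ_γ, ψ_γ′⟩ = 0` (from the `L²(ℝ)` relations of dbl-t11) -/

/-- `‖F‖² = ∫ ‖F(ξ)‖² dξ` for a class `F ∈ L²(ℝ)`. [cite: Suzuki2025WeilHilbertSpace, CJM eq. (5.8) p. 15 (‖·‖_{L²(ℝ)})] -/
theorem norm_sq_eq_integral_norm_sq (F : Lp ℂ 2 (volume : Measure ℝ)) :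
    ‖F‖ ^ 2 = ∫ ξ : ℝ, ‖(F : ℝ → ℂ) ξ‖ ^ 2 := by
  have h1 : inner ℂ F F = ((‖F‖ ^ 2 : ℝ) : ℂ) := by
    rw [inner_self_eq_norm_sq_to_K]; norm_cast
  have h2 : inner ℂ F F = ((∫ ξ : ℝ, ‖(F : ℝ → ℂ) ξ‖ ^ 2 : ℝ) : ℂ) := by
    rw [L2.inner_def, ← integral_complex_ofReal]
    refine integral_congr_ae (ae_of_all _ fun ξ ↦ ?_)
    beta_reduce
    rw [inner_self_eq_norm_sq_to_K]
    norm_cast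
  exact_mod_cast Complex.ofReal_injective (h1.symm.trans h2)

/-- **`∫_ℝ |F_γ(x)|² dx = 1`** (CJM Prop. 4.1 normalisation `‖F_γ‖_{L²} = 1`, from [Su23b] Prop. 3.2:
`∫ |i(1+Θ)/(2(x−γ))|² = π/m_γ`, dbl-t11's `integral_kernel_diag`). RH-CONSEQUENCE.
[cite: Suzuki2025WeilHilbertSpace, CJM Prop. 4.1 p. 10 ("forms an orthonormal basis") and eq. (5.11)] -/
theorem integral_norm_sq_screwBasis (hRH : RiemannHypothesis) (hρ : ρ ∈ riemannZetaNontrivialZeros) :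
    ∫ x : ℝ, ‖screwBasis ρ x‖ ^ 2 = 1 := by
  set γc := suzukiZeroParam ρ with hγc
  set γ : ℝ := γc.re with hγ
  have hγr : γc = (γ : ℂ) := suzukiZeroParam_eq_ofReal hRH hρ
  set c : ℝ := Real.sqrt ((riemannZetaZeroOrder ρ : ℝ) / Real.pi) with hc
  have hm0 : (0 : ℝ) < riemannZetaZeroOrder ρ := by
    exact_mod_cast (riemannZetaNontrivialZeros.one_le_order hρ)
  obtain ⟨-, hdiag⟩ := integral_kernel_diag hRH hρ
  have hpt : ∀ x : ℝ, lagariasE (x : ℂ) ≠ 0 → ‖screwBasis ρ x‖ ^ 2 =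
      c ^ 2 * (lagariasXiA x / (lagariasE x * (x - γc) * (x - γc))).re := by
    intro x hE
    have hprod := suzukiTerm_mul_conj_ofReal γ γ hE
    rw [← hγr] at hprod
    have hsq : ‖I * (1 + lagariasTheta x) / (2 * ((x : ℂ) - γc))‖ ^ 2 =
        (lagariasXiA x / (lagariasE x * (x - γc) * (x - γc))).re := by
      have := congrArg Complex.re hprod
      rw [Complex.mul_conj, Complex.ofReal_re, Complex.ofReal_re, Complex.normSq_eq_norm_sq] at this
      exact this
    rw [screwBasis, norm_mul, mul_pow, Complex.norm_real, Real.norm_of_nonneg (Real.sqrt_nonneg _),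
      ← hc, hsq]
  have hae : (fun x : ℝ ↦ ‖screwBasis ρ x‖ ^ 2) =ᵐ[volume]
      fun x : ℝ ↦ c ^ 2 * (lagariasXiA x / (lagariasE x * (x - γc) * (x - γc))).re := by
    filter_upwards [ae_lagariasE_ofReal_ne_zero] with x hx using hpt x hx
  rw [integral_congr_ae hae, integral_const_mul, hdiag, hc, Real.sq_sqrt (by positivity)]
  field_simp

/-- **`∫_ℝ F_{γ′}(x) conj F_γ(x) dx = 0`** for `γ ≠ γ′` (CJM Prop. 4.1 orthogonality, from [Su23b]
Prop. 3.2: dbl-t11's `integral_kernel_offDiag`). RH-CONSEQUENCE.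
[cite: Suzuki2025WeilHilbertSpace, CJM Prop. 4.1 p. 10 ("forms an orthonormal basis")] -/
theorem integral_screwBasis_mul_conj (hRH : RiemannHypothesis) {ρ' : ℂ}
    (hρ : ρ ∈ riemannZetaNontrivialZeros) (hρ' : ρ' ∈ riemannZetaNontrivialZeros) (hne : ρ' ≠ ρ) :
    Integrable (fun x : ℝ ↦ screwBasis ρ' x * conj (screwBasis ρ x)) ∧
      ∫ x : ℝ, screwBasis ρ' x * conj (screwBasis ρ x) = 0 := by
  set γc := suzukiZeroParam ρ with hγc
  set γc' := suzukiZeroParam ρ' with hγc'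
  set γ : ℝ := γc.re with hγ
  set γ' : ℝ := γc'.re with hγ'
  have hγr : γc = (γ : ℂ) := suzukiZeroParam_eq_ofReal hRH hρ
  have hγr' : γc' = (γ' : ℂ) := suzukiZeroParam_eq_ofReal hRH hρ'
  set c : ℝ := Real.sqrt ((riemannZetaZeroOrder ρ : ℝ) / Real.pi) with hc
  set c' : ℝ := Real.sqrt ((riemannZetaZeroOrder ρ' : ℝ) / Real.pi) with hc'
  obtain ⟨hint, hoff⟩ := integral_kernel_offDiag hRH hρ' hρ hne
  have hpt : ∀ x : ℝ, lagariasE (x : ℂ) ≠ 0 → screwBasis ρ' x * conj (screwBasis ρ x) =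
      (c' * c : ℂ) * ((lagariasXiA x / (lagariasE x * (x - γc') * (x - γc))).re : ℂ) := by
    intro x hE
    have hprod := suzukiTerm_mul_conj_ofReal γ' γ hE
    rw [← hγr, ← hγr'] at hprod
    rw [screwBasis, screwBasis, map_mul, Complex.conj_ofReal, ← hc, ← hc', ← hprod]
    ring
  have hae : (fun x : ℝ ↦ screwBasis ρ' x * conj (screwBasis ρ x)) =ᵐ[volume]
      fun x : ℝ ↦ (c' * c : ℂ) *
        ((lagariasXiA x / (lagariasE x * (x - γc') * (x - γc))).re : ℂ) := by
    filter_upwards [ae_lagariasE_ofReal_ne_zero] with x hx using hpt x hx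
  have hint' : Integrable fun x : ℝ ↦ (c' * c : ℂ) *
      ((lagariasXiA x / (lagariasE x * (x - γc') * (x - γc))).re : ℂ) :=
    (hint.re.ofReal).const_mul _
  refine ⟨hint'.congr hae.symm, ?_⟩
  have hre : ∫ x : ℝ, (lagariasXiA x / (lagariasE x * (x - γc') * (x - γc))).re = 0 := by
    have h := integral_re hint
    rw [hoff] at h
    simpa using h
  rw [integral_congr_ae hae, integral_const_mul, integral_complex_ofReal, hre, Complex.ofReal_zero,
    mul_zero]

/-- **`2π‖ψ_γ‖² = 1`** (Plancherel `‖ψ_γ‖ = ‖G_γ(−2π·)‖_{L²}`, the substitution `u = −2πξ`, and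
`∫|F_γ|² = 1`). RH-CONSEQUENCE. [cite: Suzuki2025WeilHilbertSpace, CJM eq. (5.11) p. 15 (TeX l.1700–1705: "2π‖ψ_γ‖² = ‖F_γ‖² = 1")] -/
theorem two_pi_mul_norm_sq_fourierInv (hRH : RiemannHypothesis) (hρ : ρ ∈ riemannZetaNontrivialZeros)
    (hGeq : ∀ z : ℂ, lagariasE z ≠ 0 → G z =
        ((Real.sqrt ((riemannZetaZeroOrder ρ : ℝ) / Real.pi) : ℝ) : ℂ) * I *
          dslope lagariasXiA (suzukiZeroParam ρ) z / lagariasE z) :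
    2 * Real.pi *
        ‖(𝓕⁻ (hG2.toLp _ : Lp ℂ 2 (volume : Measure ℝ)) : Lp ℂ 2 (volume : Measure ℝ))‖ ^ 2 = 1 := by
  set F : Lp ℂ 2 (volume : Measure ℝ) := hG2.toLp _ with hF
  have h1 : ‖(𝓕⁻ F : Lp ℂ 2 (volume : Measure ℝ))‖ = ‖F‖ := by
    rw [← Lp.norm_fourier_eq (𝓕⁻ F : Lp ℂ 2 (volume : Measure ℝ)), fourier_fourierInv_eq]
  have h2 : ‖F‖ ^ 2 = ∫ ξ : ℝ, ‖G ((-(2 * π) * ξ : ℝ) : ℂ)‖ ^ 2 := by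
    rw [norm_sq_eq_integral_norm_sq]
    refine integral_congr_ae ?_
    filter_upwards [hG2.coeFn_toLp] with ξ hξ
    rw [hξ]
  have h3 : ∫ ξ : ℝ, ‖G ((-(2 * π) * ξ : ℝ) : ℂ)‖ ^ 2 = (2 * π)⁻¹ * ∫ u : ℝ, ‖G u‖ ^ 2 := by
    rw [Measure.integral_comp_mul_left (fun u : ℝ ↦ ‖G u‖ ^ 2) (-(2 * π)), smul_eq_mul, abs_inv,
      abs_neg, abs_of_pos Real.two_pi_pos]
  have h4 : ∫ u : ℝ, ‖G u‖ ^ 2 = 1 := by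
    rw [← integral_norm_sq_screwBasis hRH hρ]
    refine integral_congr_ae ?_
    filter_upwards [continuation_ae_eq_screwBasis hρ hGeq] with u hu
    rw [hu]
  rw [h1, h2, h3, h4, mul_one, mul_inv_cancel₀ Real.two_pi_pos.ne']

end WithG

/-- **`⟨ψ_γ, ψ_γ′⟩ = 0` for `γ ≠ γ′`** (Plancherel and `∫ F_{γ′} conj F_γ = 0`). RH-CONSEQUENCE.
[cite: Suzuki2025WeilHilbertSpace, CJM eq. (5.11) p. 15 ("{ψ_γ}_{γ∈Γ} forms an orthogonal basis")] -/
theorem inner_fourierInv_fourierInv (hRH : RiemannHypothesis) {ρ ρ' : ℂ} {G G' : ℂ → ℂ}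
    (hρ : ρ ∈ riemannZetaNontrivialZeros) (hρ' : ρ' ∈ riemannZetaNontrivialZeros) (hne : ρ' ≠ ρ)
    (hGeq : ∀ z : ℂ, lagariasE z ≠ 0 → G z =
        ((Real.sqrt ((riemannZetaZeroOrder ρ : ℝ) / Real.pi) : ℝ) : ℂ) * I *
          dslope lagariasXiA (suzukiZeroParam ρ) z / lagariasE z)
    (hG'eq : ∀ z : ℂ, lagariasE z ≠ 0 → G' z =
        ((Real.sqrt ((riemannZetaZeroOrder ρ' : ℝ) / Real.pi) : ℝ) : ℂ) * I *
          dslope lagariasXiA (suzukiZeroParam ρ') z / lagariasE z)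
    (hG2 : MemLp (fun ξ : ℝ ↦ G ((-(2 * π) * ξ : ℝ) : ℂ)) 2 volume)
    (hG'2 : MemLp (fun ξ : ℝ ↦ G' ((-(2 * π) * ξ : ℝ) : ℂ)) 2 volume) :
    inner ℂ (𝓕⁻ (hG2.toLp _ : Lp ℂ 2 (volume : Measure ℝ)) : Lp ℂ 2 (volume : Measure ℝ))
      (𝓕⁻ (hG'2.toLp _ : Lp ℂ 2 (volume : Measure ℝ)) : Lp ℂ 2 (volume : Measure ℝ)) = 0 := by
  set F : Lp ℂ 2 (volume : Measure ℝ) := hG2.toLp _ with hF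
  set F' : Lp ℂ 2 (volume : Measure ℝ) := hG'2.toLp _ with hF'
  rw [← Lp.inner_fourier_eq, fourier_fourierInv_eq, fourier_fourierInv_eq, L2.inner_def]
  have h1 : ∫ ξ : ℝ, inner ℂ ((F : ℝ → ℂ) ξ) ((F' : ℝ → ℂ) ξ) =
      ∫ ξ : ℝ, (fun u : ℝ ↦ G' u * conj (G u)) (-(2 * π) * ξ) := by
    refine integral_congr_ae ?_
    filter_upwards [hG2.coeFn_toLp, hG'2.coeFn_toLp] with ξ h h'
    rw [RCLike.inner_apply, h, h']
  rw [h1, Measure.integral_comp_mul_left (fun u : ℝ ↦ G' u * conj (G u)) (-(2 * π))]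
  have h2 : ∫ u : ℝ, G' u * conj (G u) = 0 := by
    rw [← (integral_screwBasis_mul_conj hRH hρ hρ' hne).2]
    refine integral_congr_ae ?_
    filter_upwards [continuation_ae_eq_screwBasis hρ hGeq, continuation_ae_eq_screwBasis hρ' hG'eq]
      with u hu hu'
    rw [hu, hu']
  rw [h2, smul_zero]

end SuzukiOrthogonalSet

/-! ## E. Assembly: the orthogonal family, Prop. 5.8 `⟹` condition (2), and `V(0) ≠ {0}` under RH -/

open SuzukiOrthogonalSet in
/-- **The orthogonal family `{ψ_γ}_{γ∈Γ} ⊂ V(0)` under RH (clauses 1–5 of `Suzuki2025_orthogonalBasis`):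
membership in `V(0)`, the values `ψ̂_γ(γ) = 1/√(m_γπ)`, `ψ̂_γ(γ′) = 0` (CJM (4.2), (5.11)), the
normalisation `2π‖ψ_γ‖² = 1` and pairwise orthogonality — everything in CJM Prop. 4.1 / (5.11)
EXCEPT completeness (de Branges' Thm. 22), which is not proved here.** RH-CONSEQUENCE, PROVED.
[cite: Suzuki2025WeilHilbertSpace, CJM Prop. 4.1 p. 10 (TeX l.1120–1139), eq. (4.2), (5.11) p. 15] -/
theorem suzuki2025_orthogonalSet_of_riemannHypothesis (hRH : RiemannHypothesis) :
    ∃ ψb : ℂ → Lp ℂ 2 (volume : Measure ℝ),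
      (∀ ρ ∈ riemannZetaNontrivialZeros, ψb ρ ∈ suzukiV 0) ∧
      (∀ ρ ∈ riemannZetaNontrivialZeros, HasHatValue (ψb ρ) (suzukiZeroParam ρ)
          (((Real.sqrt ((riemannZetaZeroOrder ρ : ℝ) * Real.pi))⁻¹ : ℝ) : ℂ)) ∧
      (∀ ρ ∈ riemannZetaNontrivialZeros, ∀ ρ' ∈ riemannZetaNontrivialZeros,
          ρ' ≠ ρ → HasHatValue (ψb ρ) (suzukiZeroParam ρ') 0) ∧
      (∀ ρ ∈ riemannZetaNontrivialZeros, 2 * Real.pi * ‖ψb ρ‖ ^ 2 = 1) ∧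
      (∀ ρ ∈ riemannZetaNontrivialZeros, ∀ ρ' ∈ riemannZetaNontrivialZeros,
          ρ' ≠ ρ → inner ℂ (ψb ρ) (ψb ρ') = 0) := by
  classical
  -- choose the continuations `G_γ`
  have hex : ∀ ρ : ℂ, ρ ∈ riemannZetaNontrivialZeros → ∃ G : ℂ → ℂ,
      (∀ z : ℂ, 0 ≤ z.im → DifferentiableAt ℂ G z) ∧
        ∀ z : ℂ, lagariasE z ≠ 0 → G z =
          ((Real.sqrt ((riemannZetaZeroOrder ρ : ℝ) / Real.pi) : ℝ) : ℂ) * I *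
            dslope lagariasXiA (suzukiZeroParam ρ) z / lagariasE z :=
    fun ρ hρ ↦ exists_continuation hRH hρ
  set G : ℂ → ℂ → ℂ := fun ρ ↦ if hρ : ρ ∈ riemannZetaNontrivialZeros then (hex ρ hρ).choose
    else fun _ ↦ 0 with hGdef
  have hGd : ∀ ρ ∈ riemannZetaNontrivialZeros, ∀ z : ℂ, 0 ≤ z.im → DifferentiableAt ℂ (G ρ) z := by
    intro ρ hρ; rw [hGdef]; simp only [dif_pos hρ]; exact (hex ρ hρ).choose_spec.1
  have hGeq : ∀ ρ ∈ riemannZetaNontrivialZeros, ∀ z : ℂ, lagariasE z ≠ 0 → G ρ z =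
      ((Real.sqrt ((riemannZetaZeroOrder ρ : ℝ) / Real.pi) : ℝ) : ℂ) * I *
        dslope lagariasXiA (suzukiZeroParam ρ) z / lagariasE z := by
    intro ρ hρ; rw [hGdef]; simp only [dif_pos hρ]; exact (hex ρ hρ).choose_spec.2
  have hG2 : ∀ ρ ∈ riemannZetaNontrivialZeros,
      MemLp (fun ξ : ℝ ↦ G ρ ((-(2 * π) * ξ : ℝ) : ℂ)) 2 volume :=
    fun ρ hρ ↦ memLp_two_continuation_dilate hρ (hGd ρ hρ) (hGeq ρ hρ)
  -- the family
  refine ⟨fun ρ ↦ if hρ : ρ ∈ riemannZetaNontrivialZeros then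
      (𝓕⁻ ((hG2 ρ hρ).toLp _ : Lp ℂ 2 (volume : Measure ℝ)) : Lp ℂ 2 (volume : Measure ℝ)) else 0,
    ?_, ?_, ?_, ?_, ?_⟩
  · intro ρ hρ
    simp only [dif_pos hρ]
    exact fourierInv_mem_suzukiV _ hRH hρ (hGd ρ hρ) (hGeq ρ hρ)
  · intro ρ hρ
    simp only [dif_pos hρ]
    have h := hasHatValue_fourierInv (hG2 ρ hρ) hRH hρ (hGd ρ hρ) (hGeq ρ hρ) hρ
    rwa [(continuation_apply_suzukiZeroParam hRH hρ (hGd ρ hρ) (hGeq ρ hρ)).1, one_div] at h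
  · intro ρ hρ ρ' hρ' hne
    simp only [dif_pos hρ]
    have h := hasHatValue_fourierInv (hG2 ρ hρ) hRH hρ (hGd ρ hρ) (hGeq ρ hρ) hρ'
    rwa [(continuation_apply_suzukiZeroParam hRH hρ (hGd ρ hρ) (hGeq ρ hρ)).2 ρ' hρ' hne] at h
  · intro ρ hρ
    simp only [dif_pos hρ]
    exact two_pi_mul_norm_sq_fourierInv _ hRH hρ (hGeq ρ hρ)
  · intro ρ hρ ρ' hρ' hne
    simp only [dif_pos hρ, dif_pos hρ']
    exact inner_fourierInv_fourierInv hRH hρ hρ' hne (hGeq ρ hρ) (hGeq ρ' hρ') _ _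

/-- **CJM Prop. 5.8 `⟹`, condition (2): under RH, `ZeroSeparationOn (suzukiV 0)`** — with NO named
fact (the printed witnesses `ψ := √(m_γπ)·ψ_γ ∈ V(0)`: `ψ̂(γ) = 1`, `ψ̂(γ′) = 0`; any `δ`, here
`δ = 1`). This discharges the `Suzuki2025_orthogonalBasis`-dependence of the cell's
`zeroSeparationOn_of_orthogonalBasis`. RH-CONSEQUENCE, PROVED.
[cite: Suzuki2025WeilHilbertSpace, CJM Prop. 5.8 p. 17, proof of necessity (TeX l.1973–1977)] -/
theorem zeroSeparationOn_suzukiV_zero_of_riemannHypothesis (hRH : RiemannHypothesis) :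
    ZeroSeparationOn (suzukiV 0) := by
  obtain ⟨ψb, hV, hval, hvan, -, -⟩ := suzuki2025_orthogonalSet_of_riemannHypothesis hRH
  refine ⟨1, one_pos, fun ρ hρ ε hε ↦ ?_⟩
  set a : ℝ := Real.sqrt ((riemannZetaZeroOrder ρ : ℝ) * Real.pi) with ha_def
  have hm : (1 : ℝ) ≤ riemannZetaZeroOrder ρ := by
    exact_mod_cast ZetaZeros.riemannZetaNontrivialZeros.one_le_order hρ
  have ha : 0 < a := Real.sqrt_pos.2 (by positivity)
  refine ⟨(a : ℂ) • ψb ρ, (suzukiVSubmodule 0).smul_mem _ (hV ρ hρ), ?_,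
    fun ρ' hρ' hne ↦ ⟨0, ?_, ?_⟩⟩
  · have h := hasHatValue_smul (a : ℂ) (hval ρ hρ)
    have e : (a : ℂ) * (((a⁻¹ : ℝ)) : ℂ) = 1 := by
      rw [Complex.ofReal_inv, mul_inv_cancel₀]
      exact_mod_cast ha.ne'
    rwa [e] at h
  · simpa using hasHatValue_smul (a : ℂ) (hvan ρ hρ ρ' hρ' hne)
  · rw [norm_zero]; positivity

/-- Under RH, every zero `γ` gives a NONZERO element `ψ_γ ∈ V(0)` with the printed values. RH-CONSEQUENCE, PROVED.
[cite: Suzuki2025WeilHilbertSpace, CJM Remark 5.2 p. 14 (TeX l.1500–1504)] -/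
theorem exists_ne_zero_mem_suzukiV_zero_of_riemannHypothesis (hRH : RiemannHypothesis) {ρ : ℂ}
    (hρ : ρ ∈ riemannZetaNontrivialZeros) : ∃ ψ ∈ suzukiV 0, ψ ≠ 0 := by
  obtain ⟨ψb, hV, hval, -, -, -⟩ := suzuki2025_orthogonalSet_of_riemannHypothesis hRH
  refine ⟨ψb ρ, hV ρ hρ, fun h0 ↦ ?_⟩
  have h := hval ρ hρ
  rw [h0] at h
  have hz := h.eq_zero_of_zero
  have hm : (1 : ℝ) ≤ riemannZetaZeroOrder ρ := by
    exact_mod_cast ZetaZeros.riemannZetaNontrivialZeros.one_le_order hρ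
  have ha : 0 < Real.sqrt ((riemannZetaZeroOrder ρ : ℝ) * Real.pi) :=
    Real.sqrt_pos.2 (by positivity)
  have : ((Real.sqrt ((riemannZetaZeroOrder ρ : ℝ) * Real.pi))⁻¹ : ℝ) = 0 := by exact_mod_cast hz
  exact (inv_ne_zero ha.ne') this

/-- **CJM Remark 5.2 — "the RH would be false if `V(0) = {0}`", i.e. RH ⟹ `V(0) ≠ {0}` — PROVED
with NO named fact** (one non-trivial zero exists by Hardy's theorem, the tree's
`hardy_infinite_zeros_on_critical_line_holds`). Suzuki's question "prove or disprove `V(0) ≠ {0}`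
UNCONDITIONALLY" stays OPEN IN PRINT and is not touched. RH-CONSEQUENCE, PROVED.
[cite: Suzuki2025WeilHilbertSpace, CJM Remark 5.2 p. 14 (TeX l.1500–1510) (= arXiv v1 p. 3 L41–44)] -/
theorem suzukiV_zero_ne_singleton_of_riemannHypothesis (hRH : RiemannHypothesis) :
    suzukiV 0 ≠ {0} := by
  have hinf : (riemannZetaNontrivialZeros : Set ℂ).Infinite := by
    refine Set.infinite_of_injOn_mapsTo (f := fun t : ℝ ↦ (1 / 2 : ℂ) + t * I) ?_ ?_
      hardy_infinite_zeros_on_critical_line_holds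
    · intro a _ b _ hab
      have := congrArg Complex.im hab
      simpa using this
    · intro t ht
      exact mem_riemannZetaNontrivialZeros_iff_holds.2 ⟨ht, by norm_num, by norm_num⟩
  obtain ⟨ρ, hρ⟩ := hinf.nonempty
  obtain ⟨ψ, hψ, hψ0⟩ := exists_ne_zero_mem_suzukiV_zero_of_riemannHypothesis hRH hρ
  intro h
  rw [h] at hψ
  exact hψ0 hψ


end Literature.NumberTheory.LFunctions
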